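import Summits.HodgeConjecture.HodgeConjecture.Theorems.Ring2WeilCoverageCMFieldAllPrimesM
import HarnessLib

/-!
# Weil-type components over quartic CM fields, IX (part N): the INTEGER classes `[n]` of the four biquadratic
# census fields `ℚ(ζ₈)`, `ℚ(ζ₁₂)`, `ℚ(√-3,√5)`, `ℚ(i,√5)` — `[n] = [1] ⟺ the non-split primes occur to even powers`

research route conditional on HC_CM; not a corollary; Q11.4-sentence-2 already refuted in dim ≥ 3. Cell
`pub-hodge-ring2`, seat `ring2-b03` (gen 52); the instances of part M's generic integer classification
(`natCast_eq_split_iff_even`, `natCast_mk_eq_mk_iff_even`) for the four biquadratic census fields, whose prime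
classifications are parts E/F (`[ℓ] ≠ [1] ⟺ ℓ ≡ 7 (8) / 11 (12) / 11, 14 (15) / 11, 19 (20)`) and whose cofactor
obstructions `[ℓ·w] ≠ [1]` (`ℓ ∤ w`) on the non-split primes are parts A/B (no exceptional prime: `[2] = [1]` in all
four). For every `n ≥ 1`:

* `ℚ(ζ₈)` (`R = S² + 6S + 1`): `[n] = [1] ⟺` every prime `ℓ ≡ 7 (mod 8)` divides `n` to an even power;
* `ℚ(ζ₁₂)` (`R = S² + 8S + 4`): `⟺` every prime `ℓ ≡ 11 (mod 12)` divides `n` to an even power;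
* `ℚ(√-3,√5)` (`R = S² + 9S + 9`): `⟺` every prime `ℓ ≡ 11, 14 (mod 15)` divides `n` to an even power;
* `ℚ(i,√5)` (`R = S² + 3S + 1`): `⟺` every prime `ℓ ≡ 11, 19 (mod 20)` divides `n` to an even power;

with the row structure `[n₁] = [n₂] ⟺ equal parities at those primes`, and the four statements with `R` literal.
With part M (`ℚ(ζ₅)`, `ℚ(√-(2+√2))`) the rational rows `W8.E.[n]` of ALL SIX Galois census tables are classified:
`n ↦ {non-split ℓ : ℓ ∥^{odd} n}` is a complete invariant of `[n]`. No named fact, no definition, no `sorry`;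
nothing about the Hodge conjecture is asserted (index-set structure only; the general member of every row is OPEN).
References: [Deligne1982HodgeCycles] §4 p. 30 (1), Cor. 4.2, Lemma 4.6; [Landherr1936HermitianForms]. -/

noncomputable section

set_option linter.dupNamespace false

open Polynomial

namespace Summit.HodgeConjecture.HodgeConjecture.Ring2.WeilCoverageCM

open Literature.AlgebraicGeometry.Deligne1982
open Literature.AlgebraicGeometry.HodgeTheory (splitDiscriminantClassCM)

/-! ### §1 `ℚ(ζ₈)` -/

section Zeta8

variable {R : Polynomial ℤ} (hR : R = X ^ 2 + C 6 * X + C 1) [Fact (Irreducible (realPolyQ R))]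
include hR

/-- **`ℚ(ζ₈)`: `[n] = [1] ⟺ every prime `ℓ ≡ 7 (mod 8)` divides `n` to an even power** (`n ≥ 1`).
[cite: Deligne1982HodgeCycles, §4 p. 30 (1) and Cor. 4.2] [cite: Landherr1936HermitianForms] -/
theorem zeta8_natCast_eq_split_iff (n : ℕ) (hn : 1 ≤ n) (v : (realField R)ˣ) (hv : (v : realField R) = n) :
    (QuotientGroup.mk v : cmNormResidueGroup R) = splitDiscriminantClassCM R 2 ↔
      ∀ ℓ : ℕ, ℓ.Prime → ℓ % 8 = 7 → Even (n.factorization ℓ) := by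
  haveI := fact_irreducible_cmPolyQ_of_pos hR (by norm_num) (by norm_num) disc_not_sq_six_one
  refine (natCast_eq_split_iff_even (fun ℓ => ℓ % 8 ≠ 7) 1 ?_ (fun h => absurd h Nat.not_prime_one) ?_ n hn v
    hv).trans (forall_congr' fun ℓ => forall_congr' fun _ => by simp only [ne_eq, not_not])
  · intro ℓ hℓ hs u hu
    by_contra hne
    exact hs ((zeta8_mk_prime_ne_splitDiscriminantClassCM_iff hR ℓ hℓ u hu).1 hne)
  · intro ℓ hℓ hs _ w hw u hu
    exact zeta8_mk_prime_mul_ne_splitDiscriminantClassCM_of_mod_eight hR ℓ hℓ (by omega) w hw u hu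

/-- **`ℚ(ζ₈)`: `[n₁] = [n₂] ⟺ every prime `ℓ ≡ 7 (mod 8)` occurs in `n₁`, `n₂` with exponents of the same parity.**
[cite: Deligne1982HodgeCycles, §4 p. 30 (1) and Cor. 4.2] [cite: Landherr1936HermitianForms] -/
theorem zeta8_natCast_mk_eq_mk_iff {n₁ n₂ : ℕ} (hn₁ : 1 ≤ n₁) (hn₂ : 1 ≤ n₂) (u v : (realField R)ˣ)
    (hu : (u : realField R) = n₁) (hv : (v : realField R) = n₂) :
    (QuotientGroup.mk u : cmNormResidueGroup R) = QuotientGroup.mk v ↔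
      ∀ ℓ : ℕ, ℓ.Prime → ℓ % 8 = 7 → (Even (n₁.factorization ℓ) ↔ Even (n₂.factorization ℓ)) := by
  haveI := fact_irreducible_cmPolyQ_of_pos hR (by norm_num) (by norm_num) disc_not_sq_six_one
  refine (natCast_mk_eq_mk_iff_even (fun ℓ => ℓ % 8 ≠ 7) 1 ?_ (fun h => absurd h Nat.not_prime_one) ?_ hn₁ hn₂ u v
    hu hv).trans (forall_congr' fun ℓ => forall_congr' fun _ => by simp only [ne_eq, not_not])
  · intro ℓ hℓ hs u hu
    by_contra hne
    exact hs ((zeta8_mk_prime_ne_splitDiscriminantClassCM_iff hR ℓ hℓ u hu).1 hne)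
  · intro ℓ hℓ hs _ w hw u hu
    exact zeta8_mk_prime_mul_ne_splitDiscriminantClassCM_of_mod_eight hR ℓ hℓ (by omega) w hw u hu

end Zeta8

/-! ### §2 `ℚ(ζ₁₂)` -/

section Zeta12

variable {R : Polynomial ℤ} (hR : R = X ^ 2 + C 8 * X + C 4) [Fact (Irreducible (realPolyQ R))]
include hR

/-- **`ℚ(ζ₁₂)`: `[n] = [1] ⟺ every prime `ℓ ≡ 11 (mod 12)` divides `n` to an even power** (`n ≥ 1`).
[cite: Deligne1982HodgeCycles, §4 p. 30 (1) and Cor. 4.2] [cite: Landherr1936HermitianForms] -/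
theorem zeta12_natCast_eq_split_iff (n : ℕ) (hn : 1 ≤ n) (v : (realField R)ˣ) (hv : (v : realField R) = n) :
    (QuotientGroup.mk v : cmNormResidueGroup R) = splitDiscriminantClassCM R 2 ↔
      ∀ ℓ : ℕ, ℓ.Prime → ℓ % 12 = 11 → Even (n.factorization ℓ) := by
  haveI := fact_irreducible_cmPolyQ_of_pos hR (by norm_num) (by norm_num) disc_not_sq_eight_four
  refine (natCast_eq_split_iff_even (fun ℓ => ℓ % 12 ≠ 11) 1 ?_ (fun h => absurd h Nat.not_prime_one) ?_ n hn v
    hv).trans (forall_congr' fun ℓ => forall_congr' fun _ => by simp only [ne_eq, not_not])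
  · intro ℓ hℓ hs u hu
    by_contra hne
    exact hs ((zeta12_mk_prime_ne_splitDiscriminantClassCM_iff hR ℓ hℓ u hu).1 hne)
  · intro ℓ hℓ hs _ w hw u hu
    exact zeta12_mk_prime_mul_ne_splitDiscriminantClassCM_of_mod_twelve hR ℓ hℓ (by omega) w hw u hu

/-- **`ℚ(ζ₁₂)`: `[n₁] = [n₂] ⟺ every prime `ℓ ≡ 11 (mod 12)` occurs in `n₁`, `n₂` with exponents of the same
parity.** [cite: Deligne1982HodgeCycles, §4 p. 30 (1) and Cor. 4.2] [cite: Landherr1936HermitianForms] -/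
theorem zeta12_natCast_mk_eq_mk_iff {n₁ n₂ : ℕ} (hn₁ : 1 ≤ n₁) (hn₂ : 1 ≤ n₂) (u v : (realField R)ˣ)
    (hu : (u : realField R) = n₁) (hv : (v : realField R) = n₂) :
    (QuotientGroup.mk u : cmNormResidueGroup R) = QuotientGroup.mk v ↔
      ∀ ℓ : ℕ, ℓ.Prime → ℓ % 12 = 11 → (Even (n₁.factorization ℓ) ↔ Even (n₂.factorization ℓ)) := by
  haveI := fact_irreducible_cmPolyQ_of_pos hR (by norm_num) (by norm_num) disc_not_sq_eight_four
  refine (natCast_mk_eq_mk_iff_even (fun ℓ => ℓ % 12 ≠ 11) 1 ?_ (fun h => absurd h Nat.not_prime_one) ?_ hn₁ hn₂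
    u v hu hv).trans (forall_congr' fun ℓ => forall_congr' fun _ => by simp only [ne_eq, not_not])
  · intro ℓ hℓ hs u hu
    by_contra hne
    exact hs ((zeta12_mk_prime_ne_splitDiscriminantClassCM_iff hR ℓ hℓ u hu).1 hne)
  · intro ℓ hℓ hs _ w hw u hu
    exact zeta12_mk_prime_mul_ne_splitDiscriminantClassCM_of_mod_twelve hR ℓ hℓ (by omega) w hw u hu

end Zeta12

/-! ### §3 `ℚ(√-3,√5)` -/

section SqrtNeg3Sqrt5

variable {R : Polynomial ℤ} (hR : R = X ^ 2 + C 9 * X + C 9) [Fact (Irreducible (realPolyQ R))]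
include hR

/-- **`ℚ(√-3,√5)`: `[n] = [1] ⟺ every prime `ℓ ≡ 11, 14 (mod 15)` divides `n` to an even power** (`n ≥ 1`).
[cite: Deligne1982HodgeCycles, §4 p. 30 (1) and Cor. 4.2] [cite: Landherr1936HermitianForms] -/
theorem sqrtNeg3Sqrt5_natCast_eq_split_iff (n : ℕ) (hn : 1 ≤ n) (v : (realField R)ˣ)
    (hv : (v : realField R) = n) :
    (QuotientGroup.mk v : cmNormResidueGroup R) = splitDiscriminantClassCM R 2 ↔
      ∀ ℓ : ℕ, ℓ.Prime → (ℓ % 15 = 11 ∨ ℓ % 15 = 14) → Even (n.factorization ℓ) := by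
  haveI := fact_irreducible_cmPolyQ_of_pos hR (by norm_num) (by norm_num) disc_not_sq_nine_nine
  refine (natCast_eq_split_iff_even (fun ℓ => ¬ (ℓ % 15 = 11 ∨ ℓ % 15 = 14)) 1 ?_
    (fun h => absurd h Nat.not_prime_one) ?_ n hn v hv).trans
    (forall_congr' fun ℓ => forall_congr' fun _ => by simp only [not_not])
  · intro ℓ hℓ hs u hu
    by_contra hne
    exact hs ((sqrtNeg3Sqrt5_mk_prime_ne_splitDiscriminantClassCM_iff hR ℓ hℓ u hu).1 hne)
  · intro ℓ hℓ hs _ w hw u hu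
    have h := not_not.1 hs
    exact sqrtNeg3Sqrt5_mk_prime_mul_ne_splitDiscriminantClassCM_of_mod hR ℓ hℓ (by omega) (by omega) w hw u hu

/-- **`ℚ(√-3,√5)`: `[n₁] = [n₂] ⟺ every prime `ℓ ≡ 11, 14 (mod 15)` occurs in `n₁`, `n₂` with exponents of the same
parity.** [cite: Deligne1982HodgeCycles, §4 p. 30 (1) and Cor. 4.2] [cite: Landherr1936HermitianForms] -/
theorem sqrtNeg3Sqrt5_natCast_mk_eq_mk_iff {n₁ n₂ : ℕ} (hn₁ : 1 ≤ n₁) (hn₂ : 1 ≤ n₂) (u v : (realField R)ˣ)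
    (hu : (u : realField R) = n₁) (hv : (v : realField R) = n₂) :
    (QuotientGroup.mk u : cmNormResidueGroup R) = QuotientGroup.mk v ↔
      ∀ ℓ : ℕ, ℓ.Prime → (ℓ % 15 = 11 ∨ ℓ % 15 = 14) →
        (Even (n₁.factorization ℓ) ↔ Even (n₂.factorization ℓ)) := by
  haveI := fact_irreducible_cmPolyQ_of_pos hR (by norm_num) (by norm_num) disc_not_sq_nine_nine
  refine (natCast_mk_eq_mk_iff_even (fun ℓ => ¬ (ℓ % 15 = 11 ∨ ℓ % 15 = 14)) 1 ?_
    (fun h => absurd h Nat.not_prime_one) ?_ hn₁ hn₂ u v hu hv).trans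
    (forall_congr' fun ℓ => forall_congr' fun _ => by simp only [not_not])
  · intro ℓ hℓ hs u hu
    by_contra hne
    exact hs ((sqrtNeg3Sqrt5_mk_prime_ne_splitDiscriminantClassCM_iff hR ℓ hℓ u hu).1 hne)
  · intro ℓ hℓ hs _ w hw u hu
    have h := not_not.1 hs
    exact sqrtNeg3Sqrt5_mk_prime_mul_ne_splitDiscriminantClassCM_of_mod hR ℓ hℓ (by omega) (by omega) w hw u hu

end SqrtNeg3Sqrt5

/-! ### §4 `ℚ(i,√5)` -/

section SqrtNeg1Sqrt5

variable {R : Polynomial ℤ} (hR : R = X ^ 2 + C 3 * X + C 1) [Fact (Irreducible (realPolyQ R))]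
include hR

/-- **`ℚ(i,√5)`: `[n] = [1] ⟺ every prime `ℓ ≡ 11, 19 (mod 20)` divides `n` to an even power** (`n ≥ 1`).
[cite: Deligne1982HodgeCycles, §4 p. 30 (1) and Cor. 4.2] [cite: Landherr1936HermitianForms] -/
theorem sqrtNeg1Sqrt5_natCast_eq_split_iff (n : ℕ) (hn : 1 ≤ n) (v : (realField R)ˣ)
    (hv : (v : realField R) = n) :
    (QuotientGroup.mk v : cmNormResidueGroup R) = splitDiscriminantClassCM R 2 ↔
      ∀ ℓ : ℕ, ℓ.Prime → (ℓ % 20 = 11 ∨ ℓ % 20 = 19) → Even (n.factorization ℓ) := by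
  haveI := fact_irreducible_cmPolyQ_of_pos hR (by norm_num) (by norm_num) disc_not_sq_three_one
  refine (natCast_eq_split_iff_even (fun ℓ => ¬ (ℓ % 20 = 11 ∨ ℓ % 20 = 19)) 1 ?_
    (fun h => absurd h Nat.not_prime_one) ?_ n hn v hv).trans
    (forall_congr' fun ℓ => forall_congr' fun _ => by simp only [not_not])
  · intro ℓ hℓ hs u hu
    by_contra hne
    exact hs ((sqrtNeg1Sqrt5_mk_prime_ne_splitDiscriminantClassCM_iff hR ℓ hℓ u hu).1 hne)
  · intro ℓ hℓ hs _ w hw u hu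
    have h := not_not.1 hs
    exact sqrtNeg1Sqrt5_mk_prime_mul_ne_splitDiscriminantClassCM_of_mod hR ℓ hℓ (by omega) (by omega) w hw u hu

/-- **`ℚ(i,√5)`: `[n₁] = [n₂] ⟺ every prime `ℓ ≡ 11, 19 (mod 20)` occurs in `n₁`, `n₂` with exponents of the same
parity.** [cite: Deligne1982HodgeCycles, §4 p. 30 (1) and Cor. 4.2] [cite: Landherr1936HermitianForms] -/
theorem sqrtNeg1Sqrt5_natCast_mk_eq_mk_iff {n₁ n₂ : ℕ} (hn₁ : 1 ≤ n₁) (hn₂ : 1 ≤ n₂) (u v : (realField R)ˣ)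
    (hu : (u : realField R) = n₁) (hv : (v : realField R) = n₂) :
    (QuotientGroup.mk u : cmNormResidueGroup R) = QuotientGroup.mk v ↔
      ∀ ℓ : ℕ, ℓ.Prime → (ℓ % 20 = 11 ∨ ℓ % 20 = 19) →
        (Even (n₁.factorization ℓ) ↔ Even (n₂.factorization ℓ)) := by
  haveI := fact_irreducible_cmPolyQ_of_pos hR (by norm_num) (by norm_num) disc_not_sq_three_one
  refine (natCast_mk_eq_mk_iff_even (fun ℓ => ¬ (ℓ % 20 = 11 ∨ ℓ % 20 = 19)) 1 ?_
    (fun h => absurd h Nat.not_prime_one) ?_ hn₁ hn₂ u v hu hv).trans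
    (forall_congr' fun ℓ => forall_congr' fun _ => by simp only [not_not])
  · intro ℓ hℓ hs u hu
    by_contra hne
    exact hs ((sqrtNeg1Sqrt5_mk_prime_ne_splitDiscriminantClassCM_iff hR ℓ hℓ u hu).1 hne)
  · intro ℓ hℓ hs _ w hw u hu
    have h := not_not.1 hs
    exact sqrtNeg1Sqrt5_mk_prime_mul_ne_splitDiscriminantClassCM_of_mod hR ℓ hℓ (by omega) (by omega) w hw u hu

end SqrtNeg1Sqrt5

/-! ### §5 `R` literal: the integer classes of the four biquadratic census fields -/

/-- **The four biquadratic census fields, `R` LITERAL and the field `Fact`s discharged: for every `n ≥ 1`,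
`[n] = [1] ⟺` every prime `ℓ ≡ 7 (8)` / `11 (12)` / `11, 14 (15)` / `11, 19 (20)` divides `n` to an even power**
(`ℚ(ζ₈)` / `ℚ(ζ₁₂)` / `ℚ(√-3,√5)` / `ℚ(i,√5)`). [cite: Deligne1982HodgeCycles, §4 p. 30 (1) and Cor. 4.2]
[cite: Landherr1936HermitianForms] -/
theorem biquadratic_census_fields_integer_classification (n : ℕ) (hn : 1 ≤ n) :
    (haveI := fact_irreducible_realPolyQ_of_not_sq (R := X ^ 2 + C 6 * X + C 1) rfl disc_not_sq_six_one
     ∀ v : (realField (X ^ 2 + C 6 * X + C 1))ˣ, (v : realField (X ^ 2 + C 6 * X + C 1)) = n →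
       ((QuotientGroup.mk v : cmNormResidueGroup (X ^ 2 + C 6 * X + C 1)) =
          splitDiscriminantClassCM (X ^ 2 + C 6 * X + C 1) 2 ↔
        ∀ ℓ : ℕ, ℓ.Prime → ℓ % 8 = 7 → Even (n.factorization ℓ))) ∧
    (haveI := fact_irreducible_realPolyQ_of_not_sq (R := X ^ 2 + C 8 * X + C 4) rfl disc_not_sq_eight_four
     ∀ v : (realField (X ^ 2 + C 8 * X + C 4))ˣ, (v : realField (X ^ 2 + C 8 * X + C 4)) = n →
       ((QuotientGroup.mk v : cmNormResidueGroup (X ^ 2 + C 8 * X + C 4)) =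
          splitDiscriminantClassCM (X ^ 2 + C 8 * X + C 4) 2 ↔
        ∀ ℓ : ℕ, ℓ.Prime → ℓ % 12 = 11 → Even (n.factorization ℓ))) ∧
    (haveI := fact_irreducible_realPolyQ_of_not_sq (R := X ^ 2 + C 9 * X + C 9) rfl disc_not_sq_nine_nine
     ∀ v : (realField (X ^ 2 + C 9 * X + C 9))ˣ, (v : realField (X ^ 2 + C 9 * X + C 9)) = n →
       ((QuotientGroup.mk v : cmNormResidueGroup (X ^ 2 + C 9 * X + C 9)) =
          splitDiscriminantClassCM (X ^ 2 + C 9 * X + C 9) 2 ↔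
        ∀ ℓ : ℕ, ℓ.Prime → (ℓ % 15 = 11 ∨ ℓ % 15 = 14) → Even (n.factorization ℓ))) ∧
    (haveI := fact_irreducible_realPolyQ_of_not_sq (R := X ^ 2 + C 3 * X + C 1) rfl disc_not_sq_three_one
     ∀ v : (realField (X ^ 2 + C 3 * X + C 1))ˣ, (v : realField (X ^ 2 + C 3 * X + C 1)) = n →
       ((QuotientGroup.mk v : cmNormResidueGroup (X ^ 2 + C 3 * X + C 1)) =
          splitDiscriminantClassCM (X ^ 2 + C 3 * X + C 1) 2 ↔
        ∀ ℓ : ℕ, ℓ.Prime → (ℓ % 20 = 11 ∨ ℓ % 20 = 19) → Even (n.factorization ℓ))) := by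
  refine ⟨?_, ?_, ?_, ?_⟩
  · haveI := fact_irreducible_realPolyQ_of_not_sq (R := X ^ 2 + C 6 * X + C 1) rfl disc_not_sq_six_one
    exact fun v hv => zeta8_natCast_eq_split_iff rfl n hn v hv
  · haveI := fact_irreducible_realPolyQ_of_not_sq (R := X ^ 2 + C 8 * X + C 4) rfl disc_not_sq_eight_four
    exact fun v hv => zeta12_natCast_eq_split_iff rfl n hn v hv
  · haveI := fact_irreducible_realPolyQ_of_not_sq (R := X ^ 2 + C 9 * X + C 9) rfl disc_not_sq_nine_nine
    exact fun v hv => sqrtNeg3Sqrt5_natCast_eq_split_iff rfl n hn v hv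
  · haveI := fact_irreducible_realPolyQ_of_not_sq (R := X ^ 2 + C 3 * X + C 1) rfl disc_not_sq_three_one
    exact fun v hv => sqrtNeg1Sqrt5_natCast_eq_split_iff rfl n hn v hv

end Summit.HodgeConjecture.HodgeConjecture.Ring2.WeilCoverageCM

end
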